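import Literature.NumberTheory.PAdicHodge.CyclotomicTower
import Literature.NumberTheory.PAdicHodge.PrincipalUnitPowers
import HarnessLib

/-!
# Tate's normalised traces on the cyclotomic tower of `ℚ_p ⊆ F̄`

Continuation of `CyclotomicTower`. Notation: `F` a non-archimedean local field of characteristic
`0` and residue characteristic `p`, `K₀ = PadicBase F p hp ≅ ℚ_p`, `F̄ = NormedAlgClosure F`,
`G₀ = BaseGaloisGroup hp`, `ζ_{p^M} = CyclotomicTower.zeta F p M`, `K M = K₀(ζ_{p^M})`.

For a level `n ≥ 2` we FIX one element `γ = gen hp n ∈ G₀` acting on `ζ_{p^{n+1}}` by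
`ζ ↦ ζ^{1+p^n}` (`gen_smul_zeta`); it acts on every `ζ_{p^M}`, `M > n`, by `ζ ↦ ζ^{u_M}` with
`u_M = 1 + p^n a_M`, `p ∤ a_M` (`exists_smul_zeta_gen`), i.e. `γ` topologically generates
`Gal(K_∞/K n) ≅ 1 + p^n ℤ_p`. Tate's normalised trace `K M → K n` is then the AVERAGE

  `avg γ (p^{M-n}) x = p^{-(M-n)} Σ_{k < p^{M-n}} γ^k • x`  (`TateTrace.avg`),

and more generally `P_j = avg (γ^{p^{j-n}}) (p^{M-j})` is the normalised trace `K M → K j`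
(`n ≤ j ≤ M`). Working with the powers of ONE `γ` makes the transitivity `P_j = S_j ∘ P_{j+1}`
(`S_j = avg (γ^{p^{j-n}}) p`, `avg_mul`) and the commutation with `γ` exact operator identities.
We prove Tate's two estimates (Tate 1967, §3.1 Prop. 6, §3.2 Lemmas 1–2 and Prop. 7; Fontaine–
Ouyang Prop. 3.15–3.16), with explicit constants and WITHOUT differents:

* `norm_avg_le` (uniform bound): if `δ • ζ_{p^M} = ζ_{p^M}^{1 + p^j a}`, `p ∤ a`, `2 ≤ j ≤ M`, then
  `‖avg δ (p^{M-j}) z‖ ≤ ‖p‖⁻¹ ‖z‖` for all `z ∈ K M`. Proof: on `ζ^i` the sum `Σ_k δ^k ζ^i =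
  Σ_k ζ^{i u^k}` is reindexed (`PrincipalUnitPowers.sum_pow_mod_eq_sum`) into the geometric sum
  `ζ^i Σ_{t} (ζ^{i p^j})^t ∈ {p^{M-j} ζ^i, 0}`, so `‖avg (π^l ζ^i)‖ ≤ 1` (induction on `l`,
  `π = ζ - 1`), and the `π`-basis coefficient bound `CyclotomicTower.norm_coeff_le` concludes;
* `norm_sub_traceToLevel_le` (Tate's estimate): for `x ∈ K M`, `M ≥ n`,
  `‖x - P_n x‖ ≤ ‖p‖⁻² ‖γ • x - x‖` — telescoping over the layers with the one-layer bound
  `‖y - S_j y‖ ≤ ‖p‖⁻¹ ‖γ_j y - y‖` and the uniform bound for `P_{j+1}`;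
* bookkeeping: `P_n x` is fixed by `γ` (`gen_smul_traceToLevel`), `K₀`-linearity, and the
  compatibility of `P_n` when `M` grows (`traceToLevel_eq_of_mem_K`), so that the traces glue to
  `R_n : K_∞ → K n` (used in `TateTwistInvariants`).

## References

* J. Tate, *p-divisible groups* (1967), §3.1 Prop. 6, §3.2 (the operator `t`, Lemmas 1–2,
  Prop. 7). [Tate1967]
* J.-M. Fontaine, Y. Ouyang, *Theory of p-adic Galois representations*, §3.1 (Tate's normalised
  traces `R_n`, Prop. 3.15–3.16). [FontaineOuyang2022]
-/

noncomputable section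

open ValuativeRel Field UniformSpace Polynomial Finset

open scoped IntermediateField

namespace Literature.NumberTheory.PAdicHodge

open Literature.NumberTheory.GaloisRepresentations
open Literature.NumberTheory.GaloisRepresentations.IsNonarchimedeanLocalField
open CyclotomicTower

variable {F : Type} [Field F] [ValuativeRel F] [TopologicalSpace F] [IsNonarchimedeanLocalField F]
  [CharZero F] {p : ℕ} [Fact p.Prime] (hp : valuation F p < 1)

namespace TateTrace

/-! ### Averages over powers of a Galois element -/

/-- **The average `avg δ N x = N⁻¹ Σ_{k<N} δ^k • x`** of the `δ`-orbit of `x ∈ F̄` (`δ ∈ G₀`), with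
the scalar `N⁻¹ ∈ K₀`. For `δ` generating `Gal(K M/K j)` and `N = p^{M-j}` this is Tate's normalised
trace `K M → K j`. [cite: Tate1967, §3.1] -/
def avg (δ : BaseGaloisGroup hp) (N : ℕ) (x : NormedAlgClosure F) : NormedAlgClosure F :=
  ((N : PadicBase F p hp)⁻¹) • ∑ k ∈ range N, δ ^ k • x

/-- Unfolding of `avg`. [folklore] -/
theorem avg_def (δ : BaseGaloisGroup hp) (N : ℕ) (x : NormedAlgClosure F) :
    avg hp δ N x = ((N : PadicBase F p hp)⁻¹) • ∑ k ∈ range N, δ ^ k • x := rfl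

/-- `avg δ 1 = id`. [folklore] -/
theorem avg_one (δ : BaseGaloisGroup hp) (x : NormedAlgClosure F) : avg hp δ 1 x = x := by
  rw [avg_def, Finset.sum_range_one, pow_zero, one_smul, Nat.cast_one, inv_one, one_smul]

/-- Additivity. [folklore] -/
theorem avg_add (δ : BaseGaloisGroup hp) (N : ℕ) (x y : NormedAlgClosure F) :
    avg hp δ N (x + y) = avg hp δ N x + avg hp δ N y := by
  have h : ∑ k ∈ range N, δ ^ k • (x + y) =
      ∑ k ∈ range N, δ ^ k • x + ∑ k ∈ range N, δ ^ k • y := by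
    rw [← Finset.sum_add_distrib]
    exact Finset.sum_congr rfl fun k _ => smul_add _ _ _
  rw [avg_def, avg_def, avg_def, h, smul_add]

/-- `avg` of zero. [folklore] -/
theorem avg_zero (δ : BaseGaloisGroup hp) (N : ℕ) : avg hp δ N 0 = 0 := by
  rw [avg_def]
  have h : ∑ k ∈ range N, δ ^ k • (0 : NormedAlgClosure F) = 0 :=
    Finset.sum_eq_zero fun k _ => smul_zero _
  rw [h, smul_zero]

/-- `avg` of a negative. [folklore] -/
theorem avg_neg (δ : BaseGaloisGroup hp) (N : ℕ) (x : NormedAlgClosure F) :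
    avg hp δ N (-x) = -avg hp δ N x := by
  have h : avg hp δ N (-x) + avg hp δ N x = 0 := by rw [← avg_add, neg_add_cancel, avg_zero]
  exact eq_neg_of_add_eq_zero_left h

/-- `avg` commutes with subtraction. [folklore] -/
theorem avg_sub (δ : BaseGaloisGroup hp) (N : ℕ) (x y : NormedAlgClosure F) :
    avg hp δ N (x - y) = avg hp δ N x - avg hp δ N y := by
  rw [sub_eq_add_neg, avg_add, avg_neg, ← sub_eq_add_neg]

/-- `K₀`-linearity. [folklore] -/
theorem avg_smul (δ : BaseGaloisGroup hp) (N : ℕ) (c : PadicBase F p hp) (x : NormedAlgClosure F) :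
    avg hp δ N (c • x) = c • avg hp δ N x := by
  have h : ∑ k ∈ range N, δ ^ k • (c • x) = c • ∑ k ∈ range N, δ ^ k • x := by
    rw [Finset.smul_sum]
    exact Finset.sum_congr rfl fun k _ => smul_comm _ _ _
  rw [avg_def, avg_def, h, smul_comm]

/-- Linearity over finite sums with `K₀`-coefficients. [folklore] -/
theorem avg_sum_smul (δ : BaseGaloisGroup hp) (N : ℕ) (m : ℕ)
    (c : ℕ → PadicBase F p hp) (x : ℕ → NormedAlgClosure F) :
    avg hp δ N (∑ i ∈ range m, c i • x i) = ∑ i ∈ range m, c i • avg hp δ N (x i) := by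
  induction m with
  | zero => rw [Finset.sum_range_zero, Finset.sum_range_zero, avg_zero]
  | succ m ih => rw [Finset.sum_range_succ, Finset.sum_range_succ, avg_add, avg_smul, ih]

/-- **Commutation**: an element `g ∈ G₀` commuting with `δ` commutes with `avg δ N`. [folklore] -/
theorem smul_avg_of_commute {g δ : BaseGaloisGroup hp} (h : Commute g δ) (N : ℕ)
    (x : NormedAlgClosure F) : g • avg hp δ N x = avg hp δ N (g • x) := by
  have h1 : g • ∑ k ∈ range N, δ ^ k • x = ∑ k ∈ range N, δ ^ k • (g • x) := by
    rw [Finset.smul_sum]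
    refine Finset.sum_congr rfl fun k _ => ?_
    rw [← mul_smul, ← mul_smul, (h.pow_right k).eq]
  rw [avg_def, avg_def, smul_comm g, h1]

/-- `Σ_{k < a b} f k = Σ_{s<b} Σ_{r<a} f (r + a s)`. [folklore] -/
theorem sum_range_mul_eq {A : Type*} [AddCommMonoid A] (f : ℕ → A) (a b : ℕ) :
    ∑ k ∈ range (a * b), f k = ∑ s ∈ range b, ∑ r ∈ range a, f (r + a * s) := by
  induction b with
  | zero => rw [Nat.mul_zero, Finset.sum_range_zero, Finset.sum_range_zero]
  | succ b ih =>
    rw [Nat.mul_succ, Finset.sum_range_add, ih, Finset.sum_range_succ]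
    congr 1
    exact Finset.sum_congr rfl fun r _ => by rw [add_comm]

/-- **Splitting an average over `a b` steps**: `avg δ (a b) = avg δ a ∘ avg (δ^a) b` (exact identity,
`k = r + a s`). For `a = p` this is the transitivity `P_j = S_j ∘ P_{j+1}` of normalised traces.
[cite: Tate1967, §3.1] -/
theorem avg_mul (δ : BaseGaloisGroup hp) (a b : ℕ) (x : NormedAlgClosure F) :
    avg hp δ (a * b) x = avg hp δ a (avg hp (δ ^ a) b x) := by
  -- right-hand side: `a⁻¹ • Σ_r δ^r • (b⁻¹ • Σ_s (δ^a)^s • x) = (a b)⁻¹ • Σ_r Σ_s δ^{r + a s} • x`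
  have h1 : ∀ r, δ ^ r • avg hp (δ ^ a) b x =
      ((b : PadicBase F p hp)⁻¹) • ∑ s ∈ range b, δ ^ (r + a * s) • x := by
    intro r
    rw [avg_def, smul_comm, Finset.smul_sum]
    congr 1
    refine Finset.sum_congr rfl fun s _ => ?_
    rw [← mul_smul, ← pow_mul, ← pow_add]
  have h2 : ∑ r ∈ range a, δ ^ r • avg hp (δ ^ a) b x =
      ((b : PadicBase F p hp)⁻¹) • ∑ r ∈ range a, ∑ s ∈ range b, δ ^ (r + a * s) • x := by
    rw [Finset.smul_sum]
    exact Finset.sum_congr rfl fun r _ => h1 r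
  have h3 : ∑ k ∈ range (a * b), δ ^ k • x = ∑ r ∈ range a, ∑ s ∈ range b, δ ^ (r + a * s) • x := by
    rw [sum_range_mul_eq (fun k => δ ^ k • x) a b]
    exact Finset.sum_comm
  rw [avg_def, avg_def, h2, h3, smul_smul, Nat.cast_mul, mul_inv]

/-- `‖δ^b • y - y‖ ≤ ‖δ • y - y‖` (telescoping `δ^b y - y = Σ_{i<b} δ^i (δ y - y)`, isometries).
[folklore] -/
theorem norm_pow_smul_sub_le (δ : BaseGaloisGroup hp) (b : ℕ) (y : NormedAlgClosure F) :
    ‖δ ^ b • y - y‖ ≤ ‖δ • y - y‖ := by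
  have h : δ ^ b • y - y = ∑ i ∈ range b, δ ^ i • (δ • y - y) := by
    induction b with
    | zero => rw [Finset.sum_range_zero, pow_zero, one_smul, sub_self]
    | succ b ih =>
      rw [Finset.sum_range_succ, ← ih, smul_sub, ← mul_smul, ← pow_succ]
      abel
  rw [h]
  refine IsUltrametricDist.norm_sum_le_of_forall_le_of_nonneg (norm_nonneg _) fun i _ => ?_
  rw [BaseGaloisGroup.norm_smul]

/-- **One-layer estimate**: `‖y - avg δ N y‖ ≤ ‖N‖⁻¹ ‖δ • y - y‖` (for `N ≠ 0`), since
`y - avg δ N y = N⁻¹ Σ_{k<N} (y - δ^k y)`. [cite: Tate1967, §3.2 Lemma 1] -/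
theorem norm_sub_avg_le (δ : BaseGaloisGroup hp) {N : ℕ} (hN : N ≠ 0) (y : NormedAlgClosure F) :
    ‖y - avg hp δ N y‖ ≤ ‖(N : PadicBase F p hp)‖⁻¹ * ‖δ • y - y‖ := by
  have hN' : (N : PadicBase F p hp) ≠ 0 := Nat.cast_ne_zero.mpr hN
  have hsum : ∑ k ∈ range N, (y - δ ^ k • y) = (N : PadicBase F p hp) • y - ∑ k ∈ range N, δ ^ k • y := by
    have h1 : ∑ k ∈ range N, (y - δ ^ k • y) = ∑ k ∈ range N, y - ∑ k ∈ range N, δ ^ k • y :=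
      Finset.sum_sub_distrib (fun _ => y) (fun k => δ ^ k • y)
    rw [h1, Finset.sum_const, Finset.card_range, Nat.cast_smul_eq_nsmul]
  have h : y - avg hp δ N y = ((N : PadicBase F p hp)⁻¹) • ∑ k ∈ range N, (y - δ ^ k • y) := by
    rw [hsum, smul_sub, smul_smul, inv_mul_cancel₀ hN', one_smul, avg_def]
  rw [h, norm_smul_base, norm_inv]
  refine mul_le_mul_of_nonneg_left ?_ (inv_nonneg.mpr (norm_nonneg _))
  refine IsUltrametricDist.norm_sum_le_of_forall_le_of_nonneg (norm_nonneg _) fun k _ => ?_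
  rw [norm_sub_rev]; exact norm_pow_smul_sub_le hp δ k y

/-! ### Action of powers of an element on roots of unity -/

/-- If `δ • ζ = ζ^u` then `δ^k • ζ = ζ^{u^k}`. [folklore] -/
theorem pow_smul_eq_pow_pow {δ : BaseGaloisGroup hp} {ζ : NormedAlgClosure F} {u : ℕ}
    (h : δ • ζ = ζ ^ u) (k : ℕ) : δ ^ k • ζ = ζ ^ u ^ k := by
  induction k with
  | zero => simp
  | succ k ih => rw [pow_succ, mul_smul, h, smul_pow', ih, ← pow_mul, ← pow_succ]

/-! ### The uniform bound for normalised traces -/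

/-- **Evaluation on roots of unity**: if `δ • ζ_{p^M} = ζ_{p^M}^{1+p^j a}` with `p ∤ a`,
`2 ≤ j ≤ M`, then `Σ_{k < p^{M-j}} δ^k • ζ_{p^M}^i = p^{M-j} ζ_{p^M}^i` or `= 0` (reindex the
exponents `u^k mod p^M` as `1 + p^j t` and sum the geometric series in `ζ^{i p^j}`).
[cite: Tate1967, §3.1 Prop. 6] -/
theorem sum_pow_smul_zeta_pow {M j a : ℕ} (hj : 2 ≤ j) (hjM : j ≤ M) (ha : ¬p ∣ a)
    {δ : BaseGaloisGroup hp} (hδ : δ • zeta F p M = zeta F p M ^ (1 + p ^ j * a)) (i : ℕ) :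
    (∑ k ∈ range (p ^ (M - j)), δ ^ k • zeta F p M ^ i = (p ^ (M - j) : ℕ) • zeta F p M ^ i) ∨
      (∑ k ∈ range (p ^ (M - j)), δ ^ k • zeta F p M ^ i = 0) := by
  have hpP : p.Prime := Fact.out
  set ζ := zeta F p M with hζdef
  have hζ : IsPrimitiveRoot ζ (p ^ M) := zeta_spec F p M
  have horder : orderOf ζ = p ^ M := hζ.eq_orderOf.symm
  -- `δ^k • ζ^i = (ζ^{u^k mod p^M})^i`
  have hterm : ∀ k, δ ^ k • ζ ^ i = (ζ ^ ((1 + p ^ j * a) ^ k % p ^ M)) ^ i := by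
    intro k
    rw [smul_pow', pow_smul_eq_pow_pow hp hδ k, ← horder, pow_mod_orderOf]
  rw [sum_congr rfl fun k _ => hterm k,
    PrincipalUnitPowers.sum_pow_mod_eq_sum hpP hj hjM ha (fun e => (ζ ^ e) ^ i)]
  -- geometric sum in `ω = ζ^{p^j i}`
  have hgeom : ∀ t, (ζ ^ (1 + p ^ j * t)) ^ i = ζ ^ i * (ζ ^ (p ^ j * i)) ^ t := by
    intro t; rw [← pow_mul, ← pow_mul, ← pow_add]; congr 1; ring
  have hfac : ∑ t ∈ range (p ^ (M - j)), (ζ ^ (1 + p ^ j * t)) ^ i =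
      ζ ^ i * ∑ t ∈ range (p ^ (M - j)), (ζ ^ (p ^ j * i)) ^ t :=
    (Finset.sum_congr rfl fun t _ => hgeom t).trans (Finset.mul_sum _ _ _).symm
  rw [hfac]
  by_cases hω : ζ ^ (p ^ j * i) = 1
  · left
    have hs : ∑ t ∈ range (p ^ (M - j)), (ζ ^ (p ^ j * i)) ^ t = (p ^ (M - j) : ℕ) := by
      rw [hω]
      have : ∑ t ∈ range (p ^ (M - j)), (1 : NormedAlgClosure F) ^ t =
          ∑ t ∈ range (p ^ (M - j)), (1 : NormedAlgClosure F) := Finset.sum_congr rfl fun t _ => one_pow t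
      rw [this, Finset.sum_const, Finset.card_range, nsmul_eq_mul, mul_one]
    rw [hs, nsmul_eq_mul, mul_comm]
  · right
    set ω := ζ ^ (p ^ j * i) with hω'
    have hωN : ω ^ p ^ (M - j) = 1 := by
      rw [hω', ← pow_mul, show p ^ j * i * p ^ (M - j) = p ^ M * i by
        rw [mul_comm, ← mul_assoc, ← pow_add, Nat.sub_add_cancel hjM], pow_mul, hζ.pow_eq_one,
        one_pow]
    have hgs : (∑ t ∈ range (p ^ (M - j)), ω ^ t) * (ω - 1) = ω ^ p ^ (M - j) - 1 :=
      geom_sum_mul ω (p ^ (M - j))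
    rw [hωN, sub_self, mul_eq_zero] at hgs
    rw [hgs.resolve_right (sub_ne_zero.mpr hω), mul_zero]

/-- Under the same hypotheses, `‖avg δ (p^{M-j}) (ζ_{p^M}^i)‖ ≤ 1`. [cite: Tate1967, §3.1 Prop. 6] -/
theorem norm_avg_zeta_pow_le {M j a : ℕ} (hj : 2 ≤ j) (hjM : j ≤ M) (ha : ¬p ∣ a)
    {δ : BaseGaloisGroup hp} (hδ : δ • zeta F p M = zeta F p M ^ (1 + p ^ j * a)) (i : ℕ) :
    ‖avg hp δ (p ^ (M - j)) (zeta F p M ^ i)‖ ≤ 1 := by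
  have hN : ((p ^ (M - j) : ℕ) : PadicBase F p hp) ≠ 0 :=
    Nat.cast_ne_zero.mpr (pow_pos (Fact.out : p.Prime).pos _).ne'
  rw [avg_def]
  rcases sum_pow_smul_zeta_pow hp hj hjM ha hδ i with h | h
  · rw [h, ← Nat.cast_smul_eq_nsmul (PadicBase F p hp), smul_smul, inv_mul_cancel₀ hN, one_smul,
      norm_pow, norm_zeta, one_pow]
  · rw [h, smul_zero, norm_zero]; exact zero_le_one

/-- … hence `‖avg δ (p^{M-j}) (π^l ζ^i)‖ ≤ 1` for `π = ζ_{p^M} - 1` (induction on `l`: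
`π^{l+1} ζ^i = π^l ζ^{i+1} - π^l ζ^i`). [cite: Tate1967, §3.1 Prop. 6] -/
theorem norm_avg_pi_pow_mul_zeta_pow_le {M j a : ℕ} (hj : 2 ≤ j) (hjM : j ≤ M) (ha : ¬p ∣ a)
    {δ : BaseGaloisGroup hp} (hδ : δ • zeta F p M = zeta F p M ^ (1 + p ^ j * a)) (l i : ℕ) :
    ‖avg hp δ (p ^ (M - j)) ((zeta F p M - 1) ^ l * zeta F p M ^ i)‖ ≤ 1 := by
  induction l generalizing i with
  | zero => rw [pow_zero, one_mul]; exact norm_avg_zeta_pow_le hp hj hjM ha hδ i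
  | succ l ih =>
    have h : (zeta F p M - 1) ^ (l + 1) * zeta F p M ^ i =
        (zeta F p M - 1) ^ l * zeta F p M ^ (i + 1) - (zeta F p M - 1) ^ l * zeta F p M ^ i := by
      ring
    rw [h, avg_sub]
    exact (norm_sub_le_max' _ _).trans (max_le (ih (i + 1)) (ih i))

/-- **The uniform bound for normalised traces** (Tate): if `δ ∈ G₀` acts on `ζ_{p^M}` by
`ζ ↦ ζ^{1 + p^j a}` with `p ∤ a` and `2 ≤ j ≤ M`, then
`‖avg δ (p^{M-j}) z‖ ≤ ‖p‖⁻¹ ‖z‖` for every `z ∈ K M = K₀(ζ_{p^M})`.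
[cite: Tate1967, §3.1 Prop. 6] [cite: FontaineOuyang2022, §3.1 Prop. 3.15] -/
theorem norm_avg_le {M j a : ℕ} (hj : 2 ≤ j) (hjM : j ≤ M) (ha : ¬p ∣ a)
    {δ : BaseGaloisGroup hp} (hδ : δ • zeta F p M = zeta F p M ^ (1 + p ^ j * a))
    {z : NormedAlgClosure F} (hz : z ∈ K hp M) :
    ‖avg hp δ (p ^ (M - j)) z‖ ≤ ‖(p : PadicBase F p hp)‖⁻¹ * ‖z‖ := by
  have hM : 1 ≤ M := le_trans (by omega) hjM
  obtain ⟨s, hs, rfl⟩ := exists_aeval_pi_eq hp hz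
  -- expand `s(π) = Σ s_l π^l`
  have hexp : aeval (zeta F p M - 1) s =
      ∑ l ∈ range (s.natDegree + 1), s.coeff l • ((zeta F p M - 1) ^ l * zeta F p M ^ 0) := by
    rw [aeval_eq_sum_range]
    simp only [pow_zero, mul_one]
  rw [hexp, avg_sum_smul hp δ (p ^ (M - j)) (s.natDegree + 1) (fun l => s.coeff l)
    (fun l => (zeta F p M - 1) ^ l * zeta F p M ^ 0), ← hexp]
  refine IsUltrametricDist.norm_sum_le_of_forall_le_of_nonneg
    (mul_nonneg (inv_nonneg.mpr (norm_nonneg _)) (norm_nonneg _)) fun l _ => ?_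
  rw [norm_smul_base]
  calc ‖s.coeff l‖ * ‖avg hp δ (p ^ (M - j)) ((zeta F p M - 1) ^ l * zeta F p M ^ 0)‖
      ≤ ‖s.coeff l‖ * 1 := mul_le_mul_of_nonneg_left
          (norm_avg_pi_pow_mul_zeta_pow_le hp hj hjM ha hδ l 0) (norm_nonneg _)
    _ ≤ ‖(p : PadicBase F p hp)‖⁻¹ * ‖aeval (zeta F p M - 1) s‖ := by
          rw [mul_one]; exact norm_coeff_le_of_aeval_eq hp hM s hs l

/-! ### The generator `γ` of `Gal(K_∞/K n)` and its action on `ζ_{p^M}` -/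

omit [Fact p.Prime] in
/-- `gcd(1 + p^n, p) = 1` for `n ≥ 1`. [folklore] -/
theorem coprime_one_add_pow {n : ℕ} (hn : 1 ≤ n) : (1 + p ^ n).Coprime p := by
  obtain ⟨k, rfl⟩ := Nat.exists_eq_add_of_le' hn
  rw [pow_succ, Nat.coprime_add_mul_right_left]
  exact Nat.coprime_one_left p

/-- **The generator `γ = gen n ∈ G₀`**: an element acting on `ζ_{p^{n+1}}` by `ζ ↦ ζ^{1+p^n}`
(supplied by `CyclotomicTower.exists_smul_zeta_eq_pow`; for `n = 0` the junk value `1`). It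
topologically generates `Gal(K_∞/K n) ≅ 1 + p^n ℤ_p`. [cite: Tate1967, §3.1] -/
def gen (n : ℕ) : BaseGaloisGroup hp :=
  if hn : 1 ≤ n then
    (exists_smul_zeta_eq_pow hp (m := n + 1) (Nat.le_add_left 1 n) (coprime_one_add_pow hn)).choose
  else 1

/-- Defining property of `γ`: `γ • ζ_{p^{n+1}} = ζ_{p^{n+1}}^{1+p^n}`. [cite: Tate1967, §3.1] -/
theorem gen_smul_zeta {n : ℕ} (hn : 1 ≤ n) :
    gen hp n • zeta F p (n + 1) = zeta F p (n + 1) ^ (1 + p ^ n) := by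
  rw [gen, dif_pos hn]
  exact (exists_smul_zeta_eq_pow hp (m := n + 1) (Nat.le_add_left 1 n) (coprime_one_add_pow hn)).choose_spec

/-- **`γ` acts on `ζ_{p^M}` (`M > n`) by `ζ ↦ ζ^{1 + p^n a}` with `p ∤ a`** (its exponent is
`≡ 1 + p^n (mod p^{n+1})`). [cite: Tate1967, §3.1] -/
theorem exists_gen_smul_zeta {n M : ℕ} (hn : 1 ≤ n) (hM : n + 1 ≤ M) :
    ∃ a : ℕ, ¬p ∣ a ∧ gen hp n • zeta F p M = zeta F p M ^ (1 + p ^ n * a) := by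
  have hpP : p.Prime := Fact.out
  obtain ⟨c, -, hc⟩ := exists_smul_zeta_eq hp (gen hp n) M
  -- compare on `ζ_{n+1} = ζ_M^i`
  obtain ⟨i, hi⟩ := exists_zeta_eq_pow (F := F) (p := p) hM
  have h1 : zeta F p (n + 1) ^ c = zeta F p (n + 1) ^ (1 + p ^ n) := by
    rw [← gen_smul_zeta hp hn, hi, smul_pow', hc, ← pow_mul, ← pow_mul, mul_comm]
  have hζ := zeta_spec F p (n + 1)
  have hmod : c ≡ 1 + p ^ n [MOD p ^ (n + 1)] := by
    have hfin : IsOfFinOrder (zeta F p (n + 1)) :=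
      isOfFinOrder_iff_pow_eq_one.mpr ⟨p ^ (n + 1), pow_pos' (n + 1), hζ.pow_eq_one⟩
    have := (hfin.pow_eq_pow_iff_modEq).mp h1
    rwa [← hζ.eq_orderOf] at this
  -- `c = 1 + p^n (1 + p q)`
  have hlt : 1 + p ^ n < p ^ (n + 1) := by
    have h2 : 2 ≤ p := hpP.two_le
    have hpn : 2 ≤ p ^ n := le_trans h2 (Nat.le_self_pow (by omega) p)
    calc 1 + p ^ n < p ^ n + p ^ n := by omega
      _ = 2 * p ^ n := by ring
      _ ≤ p * p ^ n := Nat.mul_le_mul_right _ h2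
      _ = p ^ (n + 1) := by rw [pow_succ, mul_comm]
  have hcmod : c % p ^ (n + 1) = 1 + p ^ n := by
    rw [hmod, Nat.mod_eq_of_lt hlt]
  refine ⟨1 + p * (c / p ^ (n + 1)), ?_, ?_⟩
  · intro h
    have : p ∣ 1 := (Nat.dvd_add_left (dvd_mul_right p _)).mp h
    exact hpP.one_lt.ne' (Nat.dvd_one.mp this)
  · rw [hc]
    congr 1
    have := Nat.div_add_mod c (p ^ (n + 1))
    rw [hcmod] at this
    calc c = p ^ (n + 1) * (c / p ^ (n + 1)) + (1 + p ^ n) := this.symm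
      _ = 1 + p ^ n * (1 + p * (c / p ^ (n + 1))) := by rw [pow_succ]; ring

/-- `γ^{p^{M-n}}` acts trivially on `K M` (`M > n`): the exponent `(1 + p^n a)^{p^{M-n}} ≡ 1 (mod p^M)`.
[cite: Tate1967, §3.1] -/
theorem gen_pow_smul_eq_self {n M : ℕ} (hn : 1 ≤ n) (hM : n + 1 ≤ M) {x : NormedAlgClosure F}
    (hx : x ∈ K hp M) : gen hp n ^ p ^ (M - n) • x = x := by
  have hpP : p.Prime := Fact.out
  obtain ⟨a, -, hγ⟩ := exists_gen_smul_zeta hp hn hM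
  obtain ⟨t, ht⟩ := PrincipalUnitPowers.exists_pow_prime_pow_eq (p := p) hn a (M - n)
  have h : gen hp n ^ p ^ (M - n) • zeta F p M = (1 : BaseGaloisGroup hp) • zeta F p M := by
    rw [pow_smul_eq_pow_pow hp hγ, ht, one_smul, pow_add, pow_one, show n + (M - n) = M by omega,
      pow_mul, (zeta_spec F p M).pow_eq_one, one_pow, mul_one]
  have := smul_eq_smul_of_smul_zeta_eq hp h hx
  rwa [one_smul] at this

/-- Iterates of `γ^{p^{M-n}}` act trivially on `K M`. [folklore] -/
theorem gen_pow_pow_smul_eq_self {n M : ℕ} (hn : 1 ≤ n) (hM : n + 1 ≤ M) {x : NormedAlgClosure F}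
    (hx : x ∈ K hp M) (s : ℕ) : (gen hp n ^ p ^ (M - n)) ^ s • x = x := by
  induction s with
  | zero => rw [pow_zero, one_smul]
  | succ s ih => rw [pow_succ, mul_smul, gen_pow_smul_eq_self hp hn hM hx, ih]

/-! ### Tate's normalised traces `P_j : K M → K j` and their estimates -/

/-- **The normalised trace to level `j`** on `K M` (for the fixed generator `γ = gen n`,
`n ≤ j ≤ M`): `P_j = avg (γ^{p^{j-n}}) (p^{M-j}) = p^{-(M-j)} Σ_{k<p^{M-j}} γ^{p^{j-n} k}`.
For `j = n` this is `R_n|_{K M}` (`traceToLevel`). [cite: Tate1967, §3.1]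
[cite: FontaineOuyang2022, §3.1] -/
def traceOp (n M j : ℕ) (x : NormedAlgClosure F) : NormedAlgClosure F :=
  avg hp (gen hp n ^ p ^ (j - n)) (p ^ (M - j)) x

/-- Unfolding of `traceOp`. [folklore] -/
theorem traceOp_def (n M j : ℕ) (x : NormedAlgClosure F) :
    traceOp hp n M j x = avg hp (gen hp n ^ p ^ (j - n)) (p ^ (M - j)) x := rfl

/-- **Tate's normalised trace `R_n` on `K M`**: `traceToLevel n M = P_n = avg γ (p^{M-n})`.
[cite: Tate1967, §3.1] [cite: FontaineOuyang2022, §3.1] -/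
def traceToLevel (n M : ℕ) (x : NormedAlgClosure F) : NormedAlgClosure F :=
  avg hp (gen hp n) (p ^ (M - n)) x

/-- Unfolding of `traceToLevel`. [folklore] -/
theorem traceToLevel_def (n M : ℕ) (x : NormedAlgClosure F) :
    traceToLevel hp n M x = avg hp (gen hp n) (p ^ (M - n)) x := rfl

/-- `P_n = R_n`. [folklore] -/
theorem traceOp_self (n M : ℕ) (x : NormedAlgClosure F) : traceOp hp n M n x = traceToLevel hp n M x := by
  rw [traceOp_def, traceToLevel_def, Nat.sub_self, pow_zero, pow_one]

/-- `P_M = id`. [folklore] -/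
theorem traceOp_top (n M : ℕ) (x : NormedAlgClosure F) : traceOp hp n M M x = x := by
  rw [traceOp_def, Nat.sub_self, pow_zero, avg_one]

/-- **Transitivity**: `P_j = S_j ∘ P_{j+1}` with `S_j = avg (γ^{p^{j-n}}) p` (`n ≤ j < M`). [cite: Tate1967, §3.1] -/
theorem traceOp_eq_avg_traceOp_succ {n M j : ℕ} (hj : n ≤ j) (hjM : j < M) (x : NormedAlgClosure F) :
    traceOp hp n M j x = avg hp (gen hp n ^ p ^ (j - n)) p (traceOp hp n M (j + 1) x) := by
  rw [traceOp_def, traceOp_def, show p ^ (M - j) = p * p ^ (M - (j + 1)) by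
    rw [← pow_succ', show M - (j + 1) + 1 = M - j by omega], avg_mul, ← pow_mul, ← pow_succ,
    show j - n + 1 = j + 1 - n by omega]

/-- The exponent of `γ^{p^{j-n}}` on `ζ_{p^M}` is `1 + p^j b` with `p ∤ b` (`n ≥ 2`, `n ≤ j`, `M > n`).
[cite: Tate1967, §3.1] -/
theorem exists_gen_pow_smul_zeta {n M j : ℕ} (hn : 2 ≤ n) (hM : n + 1 ≤ M) (hj : n ≤ j) :
    ∃ b : ℕ, ¬p ∣ b ∧ gen hp n ^ p ^ (j - n) • zeta F p M = zeta F p M ^ (1 + p ^ j * b) := by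
  obtain ⟨a, ha, hγ⟩ := exists_gen_smul_zeta hp (by omega) hM
  obtain ⟨b, hb, hpb⟩ := PrincipalUnitPowers.exists_pow_prime_pow_eq_of_not_dvd (p := p) hn ha (j - n)
  refine ⟨b, hpb, ?_⟩
  rw [pow_smul_eq_pow_pow hp hγ, hb, show n + (j - n) = j by omega]

/-- **Uniform bound for `P_j`** (`n ≥ 2`, `n ≤ j ≤ M`, `M > n`): `‖P_j z‖ ≤ ‖p‖⁻¹ ‖z‖` on `K M`.
[cite: Tate1967, §3.1 Prop. 6] [cite: FontaineOuyang2022, §3.1 Prop. 3.15] -/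
theorem norm_traceOp_le {n M j : ℕ} (hn : 2 ≤ n) (hM : n + 1 ≤ M) (hj : n ≤ j) (hjM : j ≤ M)
    {z : NormedAlgClosure F} (hz : z ∈ K hp M) :
    ‖traceOp hp n M j z‖ ≤ ‖(p : PadicBase F p hp)‖⁻¹ * ‖z‖ := by
  obtain ⟨b, hpb, hδ⟩ := exists_gen_pow_smul_zeta hp hn hM hj
  rw [traceOp_def]
  exact norm_avg_le hp (le_trans hn hj) hjM hpb hδ hz

/-- `P_{j+1}` commutes with `γ^{p^{j-n}}` (all are powers of `γ`). [folklore] -/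
theorem gen_pow_smul_traceOp (n M j e : ℕ) (x : NormedAlgClosure F) :
    gen hp n ^ e • traceOp hp n M j x = traceOp hp n M j (gen hp n ^ e • x) := by
  rw [traceOp_def, traceOp_def]
  exact smul_avg_of_commute hp (Commute.pow_pow (Commute.refl (gen hp n)) e _) _ x

/-- **Tate's estimate** (Tate 1967, §3.2 Prop. 7; Fontaine–Ouyang Prop. 3.16): for `n ≥ 2`,
`M > n`, `x ∈ K M` and `n ≤ j ≤ M`,
  `‖x - P_j x‖ ≤ ‖p‖⁻² ‖γ • x - x‖`,
by downward induction on `j` (telescoping over the layers): `x - P_j x = (x - P_{j+1} x) +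
(y - S_j y)` with `y = P_{j+1} x`, `‖y - S_j y‖ ≤ ‖p‖⁻¹ ‖γ_j y - y‖ = ‖p‖⁻¹ ‖P_{j+1}(γ_j x - x)‖
≤ ‖p‖⁻² ‖γ_j x - x‖ ≤ ‖p‖⁻² ‖γ x - x‖`. [cite: Tate1967, §3.2 Prop. 7]
[cite: FontaineOuyang2022, §3.1 Prop. 3.16] -/
theorem norm_sub_traceOp_le {n M : ℕ} (hn : 2 ≤ n) (hM : n + 1 ≤ M) {x : NormedAlgClosure F}
    (hx : x ∈ K hp M) {j : ℕ} (hj : n ≤ j) (hjM : j ≤ M) :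
    ‖x - traceOp hp n M j x‖ ≤ ‖(p : PadicBase F p hp)‖⁻¹ ^ 2 * ‖gen hp n • x - x‖ := by
  set C : ℝ := ‖(p : PadicBase F p hp)‖⁻¹ with hC
  have hC0 : 0 ≤ C := inv_nonneg.mpr (norm_nonneg _)
  have hC1 : 1 ≤ C := (one_le_inv₀ (PadicBase.norm_p_pos hp)).mpr (PadicBase.norm_p_lt_one hp).le
  -- downward induction on `d = M - j`
  obtain ⟨d, rfl⟩ : ∃ d, j = M - d := ⟨M - j, by omega⟩
  have hdM : d ≤ M - n := by omega
  clear hj hjM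
  induction d with
  | zero =>
    rw [Nat.sub_zero, traceOp_top, sub_self, norm_zero]
    exact mul_nonneg (pow_nonneg hC0 2) (norm_nonneg _)
  | succ d ih =>
    have ih' := ih (by omega)
    set j := M - (d + 1) with hjdef
    have hj1 : M - d = j + 1 := by omega
    rw [hj1] at ih'
    have hnj : n ≤ j := by omega
    have hjM : j < M := by omega
    set δ := gen hp n ^ p ^ (j - n) with hδ
    set y := traceOp hp n M (j + 1) x with hy
    -- decomposition
    have hdec : x - traceOp hp n M j x = (x - y) + (y - avg hp δ p y) := by
      rw [traceOp_eq_avg_traceOp_succ hp hnj hjM]; abel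
    -- the layer term
    have hp0 : p ≠ 0 := (Fact.out : p.Prime).ne_zero
    have hlayer : ‖y - avg hp δ p y‖ ≤ C ^ 2 * ‖gen hp n • x - x‖ := by
      have h1 := norm_sub_avg_le hp δ hp0 y
      have h2 : δ • y - y = traceOp hp n M (j + 1) (δ • x - x) := by
        rw [hy, hδ, gen_pow_smul_traceOp, traceOp_def, traceOp_def, traceOp_def, avg_sub]
      have hmem : δ • x - x ∈ K hp M := sub_mem (smul_mem_K hp δ hx) hx
      have h3 := norm_traceOp_le hp hn hM (by omega : n ≤ j + 1) (by omega) hmem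
      have h4 : ‖δ • x - x‖ ≤ ‖gen hp n • x - x‖ := norm_pow_smul_sub_le hp (gen hp n) _ x
      calc ‖y - avg hp δ p y‖ ≤ C * ‖δ • y - y‖ := h1
        _ = C * ‖traceOp hp n M (j + 1) (δ • x - x)‖ := by rw [h2]
        _ ≤ C * (C * ‖δ • x - x‖) := mul_le_mul_of_nonneg_left h3 hC0
        _ ≤ C * (C * ‖gen hp n • x - x‖) :=
            mul_le_mul_of_nonneg_left (mul_le_mul_of_nonneg_left h4 hC0) hC0
        _ = C ^ 2 * ‖gen hp n • x - x‖ := by ring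
    rw [hdec]
    exact (IsUltrametricDist.norm_add_le_max _ _).trans (max_le ih' hlayer)

/-- **Tate's estimate for `R_n = P_n`**: `‖x - R_n x‖ ≤ ‖p‖⁻² ‖γ • x - x‖` for `x ∈ K M`
(`n ≥ 2`, `M > n`). [cite: Tate1967, §3.2 Prop. 7] [cite: FontaineOuyang2022, §3.1 Prop. 3.16] -/
theorem norm_sub_traceToLevel_le {n M : ℕ} (hn : 2 ≤ n) (hM : n + 1 ≤ M) {x : NormedAlgClosure F}
    (hx : x ∈ K hp M) :
    ‖x - traceToLevel hp n M x‖ ≤ ‖(p : PadicBase F p hp)‖⁻¹ ^ 2 * ‖gen hp n • x - x‖ := by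
  rw [← traceOp_self]
  exact norm_sub_traceOp_le hp hn hM hx le_rfl (by omega)

/-- **Uniform bound for `R_n`**: `‖R_n z‖ ≤ ‖p‖⁻¹ ‖z‖` on `K M` (`n ≥ 2`, `M > n`).
[cite: Tate1967, §3.1 Prop. 6] -/
theorem norm_traceToLevel_le {n M : ℕ} (hn : 2 ≤ n) (hM : n + 1 ≤ M) {z : NormedAlgClosure F}
    (hz : z ∈ K hp M) : ‖traceToLevel hp n M z‖ ≤ ‖(p : PadicBase F p hp)‖⁻¹ * ‖z‖ := by
  rw [← traceOp_self]
  exact norm_traceOp_le hp hn hM le_rfl (by omega) hz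

/-! ### Bookkeeping: `γ`-invariance, linearity, compatibility in `M` -/

/-- **`R_n x` is fixed by `γ`** (`x ∈ K M`, `M > n`): `γ • R_n x - R_n x = p^{-(M-n)}(γ^{p^{M-n}} x - x) = 0`.
[cite: Tate1967, §3.1] -/
theorem gen_smul_traceToLevel {n M : ℕ} (hn : 1 ≤ n) (hM : n + 1 ≤ M) {x : NormedAlgClosure F}
    (hx : x ∈ K hp M) : gen hp n • traceToLevel hp n M x = traceToLevel hp n M x := by
  set N := p ^ (M - n) with hN
  have hN0 : (N : PadicBase F p hp) ≠ 0 := Nat.cast_ne_zero.mpr (pow_pos (Fact.out : p.Prime).pos _).ne'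
  rw [traceToLevel_def, smul_avg_of_commute hp (Commute.refl _), avg_def, avg_def]
  congr 1
  -- `Σ_{k<N} γ^k γ x = Σ_{k<N} γ^k x + (γ^N x - x)`
  have htel : ∑ k ∈ range N, (gen hp n ^ (k + 1) • x - gen hp n ^ k • x) = gen hp n ^ N • x - x := by
    have := Finset.sum_range_sub (fun k => gen hp n ^ k • x) N
    rwa [pow_zero, one_smul] at this
  have h1 : ∑ k ∈ range N, gen hp n ^ k • gen hp n • x =
      ∑ k ∈ range N, gen hp n ^ k • x + ∑ k ∈ range N, (gen hp n ^ (k + 1) • x - gen hp n ^ k • x) := by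
    rw [← Finset.sum_add_distrib]
    refine Finset.sum_congr rfl fun k _ => ?_
    rw [← mul_smul, ← pow_succ]; abel
  rw [h1, htel, hN, gen_pow_smul_eq_self hp hn hM hx, sub_self, add_zero]

/-- `R_n` is `K₀`-linear. [folklore] -/
theorem traceToLevel_smul (n M : ℕ) (c : PadicBase F p hp) (x : NormedAlgClosure F) :
    traceToLevel hp n M (c • x) = c • traceToLevel hp n M x :=
  avg_smul hp _ _ c x

/-- `R_n` is additive. [folklore] -/
theorem traceToLevel_add (n M : ℕ) (x y : NormedAlgClosure F) :
    traceToLevel hp n M (x + y) = traceToLevel hp n M x + traceToLevel hp n M y :=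
  avg_add hp _ _ x y

/-- `R_n` commutes with subtraction. [folklore] -/
theorem traceToLevel_sub (n M : ℕ) (x y : NormedAlgClosure F) :
    traceToLevel hp n M (x - y) = traceToLevel hp n M x - traceToLevel hp n M y :=
  avg_sub hp _ _ x y

/-- `R_n` commutes with `γ`. [folklore] -/
theorem gen_smul_traceToLevel_eq (n M : ℕ) (x : NormedAlgClosure F) :
    gen hp n • traceToLevel hp n M x = traceToLevel hp n M (gen hp n • x) :=
  smul_avg_of_commute hp (Commute.refl _) _ x

/-- **Compatibility in `M`**: on `K M` the traces computed at levels `M ≤ M'` agree, so that the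
`traceToLevel n M` glue to one operator `R_n` on `K_∞ = ⋃ K M`. [cite: Tate1967, §3.1] -/
theorem traceToLevel_eq_of_mem_K {n M M' : ℕ} (hn : 1 ≤ n) (hM : n + 1 ≤ M) (hMM' : M ≤ M')
    {x : NormedAlgClosure F} (hx : x ∈ K hp M) :
    traceToLevel hp n M' x = traceToLevel hp n M x := by
  set c := p ^ (M' - M) with hc
  have hc0 : (c : PadicBase F p hp) ≠ 0 := Nat.cast_ne_zero.mpr (pow_pos (Fact.out : p.Prime).pos _).ne'
  rw [traceToLevel_def, traceToLevel_def, show p ^ (M' - n) = p ^ (M - n) * c by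
    rw [hc, ← pow_add]; congr 1; omega, avg_mul]
  congr 1
  -- `avg (γ^{p^{M-n}}) c x = x`
  rw [avg_def]
  have h : ∑ s ∈ range c, (gen hp n ^ p ^ (M - n)) ^ s • x = ∑ s ∈ range c, x :=
    Finset.sum_congr rfl fun s _ => gen_pow_pow_smul_eq_self hp hn hM hx s
  rw [h, Finset.sum_const, Finset.card_range, ← Nat.cast_smul_eq_nsmul (PadicBase F p hp), smul_smul,
    inv_mul_cancel₀ hc0, one_smul]

end TateTrace

end Literature.NumberTheory.PAdicHodge

end
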